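import Summits.BirchSwinnertonDyer.BirchSwinnertonDyer.Theorems.PrintCf2OffTYZKummerLaws
import Summits.BirchSwinnertonDyer.BirchSwinnertonDyer.Theorems.PrintCf2RamifiedTYZFamilies
import Summits.BirchSwinnertonDyer.BirchSwinnertonDyer.Theorems.PrintCf2RamifiedOffTYZThetaLeaf
import Summits.BirchSwinnertonDyer.BirchSwinnertonDyer.Theorems.PrintCf2RamifiedOffTYZThetaCriterionLeaf
import Summits.BirchSwinnertonDyer.Rank1Residual.WAll.AltClosersCMTwoRamifiedGenusClass
import Summits.BirchSwinnertonDyer.Rank1Residual.P2.ShuZhaiTwoFiftySixSlices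
import HarnessLib

/-!
# Crux 20509 `RamifiedOffTYZOfFacts` and C⁺ = item 23431 BY NAME, as EQUIVALENCES modulo named prints:
# «C⁺ ⟺ the three named Kummer laws» and «crux ⟺ C⁺ ∧ residual ⟺ laws ∧ residual»
# (cell `bsd-print-cf2`, route `PrintCf2`, line `offtyz-v7`, LEAD cruxlead-20509 g35, lineage cycle 36; skeleton v15)

HONEST FRAMING (`--supports stmt-BirchSwinnertonDyer-20509 --as helper`; theorems only, `def`-free, no `sorry`, NO new named fact;
std axioms).  BSD is not proved by any of this; no class is closed by this file; 20509 / 23431 / 23432 stay OPEN; BSD is proved for no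
curve.  Every hypothesis below is a NAMED declaration of the tree (printed facts `def … : Prop` of `Literature/…`, the three
`@[conjecture] def`s of `Theorems/PrintCf2OffTYZKummerLaws.lean`, route items of `Theses/PrintCf2.lean`) — nothing is spelled inline
except the route bundle 𝔅_ram itself (a conjunction of eleven named facts, verbatim as in the route file).

WHY THIS FILE.  Director-bsd ruling (790)(B) (2026-08-31) made the three CONJECTURE-GRADE stubs of the registered skeleton
(`Cruxes/RamifiedOffTYZOfFacts/Lines/offtyz_v14.lean` → v15) NAMED CONJECTURES of the tree:
`OffTYZKummerLaws.LawZPlusSecondNormVisibleR2` (LAW Z⁺ / second-norm law on the visible R2 class rows, rung 1 of the `(1+i)`-ladder),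
`OffTYZKummerLaws.LawLevelTwoInvisibleR2` (rungs 2–3), `OffTYZKummerLaws.LawLevelTwoOffR2` (off-R2 remainder) — p817582 — and skeleton v15
(this seat, sha16 `22a633dcdabd19ce`) restates the stubs BY NAME.  The registry certifies «stubs ⟹ crux» modulo `sorry`.  THIS FILE puts the
CONVERSES next to it, in the kernel and by name, so that the wall label «20509 / 23431 closable only modulo three OPEN conjectural laws»
is an EQUIVALENCE of record and not a one-way reduction:

* §1 ★ `laws_of_levelTwo` — **C⁺ ⟹ the three laws, UNCONDITIONALLY** (`RamifiedJumpOneLevelTwoOfFacts → LawZ⁺ ∧ LawInvisR2 ∧ LawOffR2`):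
  the invisible-R2 and off-R2 laws are restrictions of C⁺'s text; LAW Z⁺ is C⁺ read on the CM realisation through exact descent
  (`SecondNormLawsValue.secondNormLaw_value_of_levelTwoScriptLExact`, p810804 / p803014 §3 — conjuncts 1, 2, 4, 5 of 𝔅_ram, which the law
  carries as its own antecedent).
* §1 ★ `levelTwo_of_laws` — **𝔅_ram ∧ value door ∧ THEOREM A's print door ∧ the three laws ⟹ C⁺** (skeleton v15's composition
  `offTYZ_levelTwoScriptLExact_of_recut` with the stubs as named hypotheses; THEOREM A is the kernel theorem p814853).
* §1 ★★ `levelTwo_iff_laws` — **granted 𝔅_ram and the two print doors, C⁺ ⟺ LawZ⁺ ∧ LawInvisR2 ∧ LawOffR2.**  Nothing of C⁺ was lost or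
  added by the re-cut v10 → v15.
* §2 `levelTwo_of_ramifiedOffTYZ`, `offJumpOne_of_ramifiedOffTYZ` — **granted 𝔅_ram, the crux ⟹ C⁺ and the crux ⟹ the residual 23432**
  (crux ∧ 𝔅_ram ⟹ the whole ramified slice `WAllCornerFTwoRamified` by `ramifiedTwoRankOne_of_bundle_of_offTYZProved`, p536500's glue — the ON-TYZ
  part is in-bundle; then the level-two door `P2.bsdp_two_congruentNumberCurve_iff_two_dvd_not_four_dvd` on `E_n`, CM by `ℤ[i]`, `2 ∣ d_K`).
* §2 ★★ `ramifiedOffTYZ_iff_levelTwo_and_offJumpOne_of_namedFacts` — **granted 𝔅_ram and the EIGHT named prints that open the six in-bundle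
  doors** (`tyz_genusPointData` (U⁺), `tyz_cmPointGaloisData` + `thm11_parity_of_scriptL` (Θ, Θ₄, Θ-criterion), Shu–Zhai `thm12_ranks_of_twists` +
  `thm14_twoPartBSD_of_twists` + Agashe–Ribet–Stein + `base256c1_optimal_cuspZero` (256c1), Creutz–Miller/Miller–Stoll
  `bsdTriple_of_analyticRank_le_one_of_conductor_lt` (conductor < 5000)): **crux 20509 ⟺ item 23431 ∧ item 23432**; and
  ★★ `ramifiedOffTYZ_iff_laws_and_offJumpOne_of_namedFacts` — with the two C⁺ print doors as well: **crux 20509 ⟺ (LawZ⁺ ∧ LawInvisR2 ∧ LawOffR2) ∧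
  item 23432.**  So the EXACT dependency list of 20509 of record is: 𝔅_ram (11 named facts) + 10 named print facts (8 doors + value door +
  THEOREM A's prints; all `def … : Prop`, none discharged, none expected to be soon) + 3 named OPEN conjectures + 1 open route item (23432,
  the named residual: `j = 8000`, quartic twists with no `E_m`, `Ш[2] ≠ 0` members …) — and conversely each of those four open things is
  IMPLIED by the crux granted the prints.  The skeleton registry (v15) is the `sorry`-carrying forward half of exactly this statement.

References: [cite: TianYuanZhang2017, §1, §3.1–3.2, Thm. 1.1, Thm. 1.2, Thm. 3.5]; [cite: Tian2014, Thm. 1.3]; [cite: ShuZhai2021, Thm. 1.2, Thm. 1.4];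
[cite: AgasheRibetStein2006, Thm. 2.6]; [cite: CreutzMiller2012, Thm. 1.1]; [cite: MillerStoll2012, Thm. 9.1]; [cite: Miller2011LMS, Def. 1.1];
[cite: Yang2006DefiningEquations, §4.1]; [cite: Cox2013, Thm. 15.16–15.17]; tree: p536500, p650357, p803014, p810804, p811245, p814853, p816665, p817582.
-/

noncomputable section

open scoped Classical

open Summit.BirchSwinnertonDyer Summit.BirchSwinnertonDyer.BirchSwinnertonDyer.Theses.PrintCf2
open Literature.NumberTheory.EllipticCurves Literature.NumberTheory.EllipticCurves.TianYuanZhang2017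
open Summit.BirchSwinnertonDyer.PrintCf2.OffTYZKummerLaws

set_option autoImplicit false

namespace Summit.BirchSwinnertonDyer.PrintCf2.NamedLawsClosure

/-! ## §1 C⁺ = item 23431 `RamifiedJumpOneLevelTwoOfFacts` versus the three named laws -/

/-- ★ **C⁺ ⟹ the three named Kummer laws, unconditionally.**  The invisible-R2 law and the off-R2 remainder are C⁺'s text restricted
to sub-rows (their extra hypotheses are dropped); LAW Z⁺ (the second-norm law on the visible R2 class rows for the CM realisation) is
C⁺ pushed through exact descent by `SecondNormLawsValue.secondNormLaw_value_of_levelTwoScriptLExact`, whose inputs GZK, modularity,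
Rubin's CM triple at `L(1) ≠ 0` and TYZ Thm 1.2′ are conjuncts 1, 2, 4, 5 of the bundle 𝔅_ram that the law carries as antecedent.
[cite: TianYuanZhang2017, §1, §3.1, §3.2, Thm. 3.5, Lemma 3.18, Thm. 1.2] [cite: BurungaleFlach2024, Thm 1.1 / Cor. 3] [cite: Darmon2004, Thm. 3.22] -/
theorem laws_of_levelTwo (hC : RamifiedJumpOneLevelTwoOfFacts) :
    LawZPlusSecondNormVisibleR2 ∧ LawLevelTwoInvisibleR2 ∧ LawLevelTwoOffR2 := by
  refine ⟨?_, ?_, ?_⟩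
  · intro hB l q n hl hq hl8 hq8 _hlq hn hr hSel2 hSel4 hvis D hPr hCo hBl M iF iN iG ι x₀ y₀ h₀ Φ hS1 hS2 hS3 hS4 N₁ N₀
      hN₁ hN₀ hA1
    exact @SecondNormLawsValue.secondNormLaw_value_of_levelTwoScriptLExact _ hB.1 hB.2.1 hB.2.2.2.1 hB.2.2.2.2.1 hC _ _ hl hq
      hl8 hq8 hn hr hSel2 hSel4 hvis D hPr hCo hBl M iF iN iG ι x₀ y₀ h₀ Φ hS1 hS2 hS3 hS4 _ _ hN₁ hN₀ hA1
  · intro _hB n _ _ hsq h8 hr hSel2 hSel4 _hR2 _hinv L hL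
    exact hC n hsq h8 hr hSel2 hSel4 L hL
  · intro _hB n _ _ hsq h8 hr hSel2 hSel4 _hR2 _hF _hT L hL
    exact hC n hsq h8 hr hSel2 hSel4 L hL

/-- **C⁺ off the visible R2 rows (skeleton v10–v13's remainder text) from the two named laws `LawLevelTwoInvisibleR2`,
`LawLevelTwoOffR2` and the printed-family discharge** `RemainderPrintedFamilies.offTYZ_levelTwo_of_isCor515Family` /
`…_of_tian2014Family` (p816665: `#Sel₂ = 8 ≠ 2⁵` there) — skeleton v14/v15's `offTYZ_levelTwo_offVisR2_of_recut` with the stubs as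
named hypotheses (decidable case split: R2 shape? Monsky Cor. 5.15 member? Tian 2014 member?).
[cite: Monsky1990MockHeegner, Cor. 5.15] [cite: Tian2014, Thm. 1.3] [cite: SilvermanAEC2009, Thm. X.4.2] -/
theorem offVisR2_of_laws (hI : LawLevelTwoInvisibleR2) (hO : LawLevelTwoOffR2) : (Literature.NumberTheory.EllipticCurves.rank_eq_analyticRank_of_analyticRank_le_one ∧ WeierstrassCurve.hasEntireLFunction_rat ∧ WeierstrassCurve.bsdRHS_eq_of_isIsogenous ∧ Literature.NumberTheory.EllipticCurves.bsdTriple_of_hasCM_of_L_one_ne_zero ∧ Literature.NumberTheory.EllipticCurves.TianYuanZhang2017.thm12_parity_of_scriptL' ∧ Literature.NumberTheory.EllipticCurves.Tian2014.thm13_rank_one_and_sha_odd ∧ Literature.NumberTheory.QuadraticFields.RedeiReichardt.redeiReichardt_fourTwoCard_classGroup ∧ Literature.NumberTheory.EllipticCurves.LiLiuTian2024.thm12_bsd_congruentNumberCurve ∧ Literature.NumberTheory.EllipticCurves.Monsky1990.cor515_rank_eq_one_and_card_selmerGroup_two ∧ Literature.NumberTheory.EllipticCurves.HeathBrown1994.monsky_card_selmerGroup_two_even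 ∧ Literature.NumberTheory.EllipticCurves.Tian2014.tian2014_system_sMinus_genus) →
    ∀ (n : ℕ) [(congruentNumberCurve n).IsElliptic] [(congruentNumberCurve n).IsGloballyMinimal],
      Squarefree n → (n % 8 = 5 ∨ n % 8 = 6 ∨ n % 8 = 7) →
      (congruentNumberCurve n).analyticRank = 1 →
      Nat.card ((congruentNumberCurve n).selmerGroup 2) = 2 ^ 5 →
      Nat.card ((congruentNumberCurve n).selmerGroup 4) = 2 ^ 6 →
      ¬ ((∃ l q : ℕ, l.Prime ∧ q.Prime ∧ l % 8 = 1 ∧ q % 8 = 7 ∧ IsSquare ((l : ℤ) : ZMod q) ∧ n = l * q) ∧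
          (∃ (X Y : ℚ) (h : (Literature.NumberTheory.EllipticCurves.TianYuanZhang2017.W2.Atwo n).toAffine.Nonsingular X Y),
            (∀ P : (Literature.NumberTheory.EllipticCurves.TianYuanZhang2017.W2.Atwo n).toAffine.Point, ∃ m : ℤ, IsOfFinAddOrder (P - m • (WeierstrassCurve.Affine.Point.some X Y h : (Literature.NumberTheory.EllipticCurves.TianYuanZhang2017.W2.Atwo n).toAffine.Point))) ∧
              ¬ ∃ s : ℚ, X = 2 * s ^ 2)) →
      ∀ L : ℤ, IsScriptL n L → (2 : ℤ) ∣ L ∧ ¬ (4 : ℤ) ∣ L := by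
  intro hB n _ _ hsq h8 hr hSel2 hSel4 hnot L hL
  by_cases hR2 : (∃ l q : ℕ, l.Prime ∧ q.Prime ∧ l % 8 = 1 ∧ q % 8 = 7 ∧ IsSquare ((l : ℤ) : ZMod q) ∧ n = l * q)
  · exact hI hB n hsq h8 hr hSel2 hSel4 hR2 (fun hV => hnot ⟨hR2, hV⟩) L hL
  · by_cases hF : Literature.NumberTheory.EllipticCurves.Monsky1990.IsCor515Family n
    · exact RemainderPrintedFamilies.offTYZ_levelTwo_of_isCor515Family hB n hF hSel2 L hL
    · by_cases hT : (∃ (k : ℕ) (p : Fin (k + 1) → ℕ) (n₀ : ℕ) (K : Type) (_ : Field K) (_ : NumberField K),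
            (∀ i, (p i).Prime) ∧ (∀ i, p i ≠ 2) ∧ Function.Injective p ∧ (∀ i, i ≠ 0 → p i % 8 = 1) ∧ n₀ = ∏ i, p i ∧
            Literature.NumberTheory.EllipticCurves.Tian2014.IsQuadraticFieldOfSqrt K (-(2 * n₀ : ℤ)) ∧
            Literature.NumberTheory.EllipticCurves.Tian2014.Condition11 n₀ K ∧ (n = n₀ ∨ n = 2 * n₀))
      · obtain ⟨k, p, n₀, K, _instF, _instN, hp, hp2, hinj, h1, hn₀, hK, hC, hm⟩ := hT
        exact RemainderPrintedFamilies.offTYZ_levelTwo_of_tian2014Family hB k p hp hp2 hinj h1 n₀ hn₀ K hK hC n hm h8 hSel2 L hL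
      · exact hO hB n hsq h8 hr hSel2 hSel4 hR2 hF hT L hL

/-- ★ **𝔅_ram ∧ the TYZ value door ∧ THEOREM A's print door ∧ the three named laws ⟹ C⁺** — skeleton v15's derivation
`offTYZ_levelTwoScriptLExact_of_recut` with the three conjecture-grade stubs replaced by the named conjectures as hypotheses: the
composition `SecondNormLawsPrints.levelTwoScriptLExact_of_laws_prints` (p811245) fed with THEOREM A (the kernel theorem
`stub_offTYZ_firstNormSquare_R2`, p814853), LAW Z⁺, and the remainder of `offVisR2_of_laws`.
[cite: TianYuanZhang2017, §1, §3.1, §3.2, Thm. 3.5, Lemma 3.18, Lemma 3.21] [cite: Yang2006DefiningEquations, §4.1] [cite: Cox2013, Thm. 15.16, Thm. 15.17] -/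
theorem levelTwo_of_laws (hB : (Literature.NumberTheory.EllipticCurves.rank_eq_analyticRank_of_analyticRank_le_one ∧ WeierstrassCurve.hasEntireLFunction_rat ∧ WeierstrassCurve.bsdRHS_eq_of_isIsogenous ∧ Literature.NumberTheory.EllipticCurves.bsdTriple_of_hasCM_of_L_one_ne_zero ∧ Literature.NumberTheory.EllipticCurves.TianYuanZhang2017.thm12_parity_of_scriptL' ∧ Literature.NumberTheory.EllipticCurves.Tian2014.thm13_rank_one_and_sha_odd ∧ Literature.NumberTheory.QuadraticFields.RedeiReichardt.redeiReichardt_fourTwoCard_classGroup ∧ Literature.NumberTheory.EllipticCurves.LiLiuTian2024.thm12_bsd_congruentNumberCurve ∧ Literature.NumberTheory.EllipticCurves.Monsky1990.cor515_rank_eq_one_and_card_selmerGroup_two ∧ Literature.NumberTheory.EllipticCurves.HeathBrown1994.monsky_card_selmerGroup_two_even ∧ Literature.NumberTheory.EllipticCurves.Tian2014.tian2014_system_sMinus_genus))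
    (hT : Literature.NumberTheory.EllipticCurves.TianYuanZhang2017.tyz_sevenBlockCMValueData)
    (hP : (Literature.NumberTheory.EllipticCurves.ModularForms.x032_φ_eq_etaQuotient ∧ Literature.NumberTheory.EllipticCurves.ModularForms.x032_φ_injective ∧ Literature.NumberTheory.ComplexMultiplication.Cox2013.cox2013_shimuraReciprocity_rayClassField))
    (hZ : LawZPlusSecondNormVisibleR2) (hI : LawLevelTwoInvisibleR2) (hO : LawLevelTwoOffR2) :
    RamifiedJumpOneLevelTwoOfFacts :=
  SecondNormLawsPrints.levelTwoScriptLExact_of_laws_prints hB hT (stub_offTYZ_firstNormSquare_R2 hB hP) hZ (offVisR2_of_laws hI hO)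

/-- ★★ **Granted 𝔅_ram and the two print doors of C⁺'s re-cut, item 23431 is EQUIVALENT to the conjunction of the three named laws**:
`RamifiedJumpOneLevelTwoOfFacts ⟺ LawZ⁺ ∧ LawInvisR2 ∧ LawOffR2`.  The forward half is unconditional (`laws_of_levelTwo`).
[cite: TianYuanZhang2017, §1, §3.1–3.2, Thm. 3.5] [cite: Yang2006DefiningEquations, §4.1] [cite: Cox2013, Thm. 15.16, Thm. 15.17] -/
theorem levelTwo_iff_laws (hB : (Literature.NumberTheory.EllipticCurves.rank_eq_analyticRank_of_analyticRank_le_one ∧ WeierstrassCurve.hasEntireLFunction_rat ∧ WeierstrassCurve.bsdRHS_eq_of_isIsogenous ∧ Literature.NumberTheory.EllipticCurves.bsdTriple_of_hasCM_of_L_one_ne_zero ∧ Literature.NumberTheory.EllipticCurves.TianYuanZhang2017.thm12_parity_of_scriptL' ∧ Literature.NumberTheory.EllipticCurves.Tian2014.thm13_rank_one_and_sha_odd ∧ Literature.NumberTheory.QuadraticFields.RedeiReichardt.redeiReichardt_fourTwoCard_classGroup ∧ Literature.NumberTheory.EllipticCurves.LiLiuTian2024.thm12_bsd_congruentNumberCurve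 ∧ Literature.NumberTheory.EllipticCurves.Monsky1990.cor515_rank_eq_one_and_card_selmerGroup_two ∧ Literature.NumberTheory.EllipticCurves.HeathBrown1994.monsky_card_selmerGroup_two_even ∧ Literature.NumberTheory.EllipticCurves.Tian2014.tian2014_system_sMinus_genus))
    (hT : Literature.NumberTheory.EllipticCurves.TianYuanZhang2017.tyz_sevenBlockCMValueData)
    (hP : (Literature.NumberTheory.EllipticCurves.ModularForms.x032_φ_eq_etaQuotient ∧ Literature.NumberTheory.EllipticCurves.ModularForms.x032_φ_injective ∧ Literature.NumberTheory.ComplexMultiplication.Cox2013.cox2013_shimuraReciprocity_rayClassField)) :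
    RamifiedJumpOneLevelTwoOfFacts ↔ (LawZPlusSecondNormVisibleR2 ∧ LawLevelTwoInvisibleR2 ∧ LawLevelTwoOffR2) :=
  ⟨laws_of_levelTwo, fun h => levelTwo_of_laws hB hT hP h.1 h.2.1 h.2.2⟩

/-! ## §2 Crux 20509 `RamifiedOffTYZOfFacts` versus item 23431, item 23432 and the laws -/

/-- **Granted 𝔅_ram, the crux gives the WHOLE ramified slice** `WAllCornerFTwoRamified` (CM, `ord_{s=1} L(E,s) = 1`, `2 ∣ d_K` ⟹ `BSD(E,2)`):
the ON-TYZ part is in-bundle (`wAllCornerFTwoRamifiedTYZProved_of_bundle`), the OFF part is the crux's conclusion — p536500's glue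
`ramifiedTwoRankOne_of_bundle_of_offTYZProved`, restated with the slice by name; and conversely the slice restricts to the crux's conclusion.
[cite: TianYuanZhang2017, Thm. 1.2] [cite: Tian2014, Thm. 1.3] [cite: LiLiuTian2024, Thm. 1.2] [cite: Miller2011LMS, Def. 1.1] -/
theorem ramifiedOffTYZ_iff_wAllCornerFTwoRamified (hB : (Literature.NumberTheory.EllipticCurves.rank_eq_analyticRank_of_analyticRank_le_one ∧ WeierstrassCurve.hasEntireLFunction_rat ∧ WeierstrassCurve.bsdRHS_eq_of_isIsogenous ∧ Literature.NumberTheory.EllipticCurves.bsdTriple_of_hasCM_of_L_one_ne_zero ∧ Literature.NumberTheory.EllipticCurves.TianYuanZhang2017.thm12_parity_of_scriptL' ∧ Literature.NumberTheory.EllipticCurves.Tian2014.thm13_rank_one_and_sha_odd ∧ Literature.NumberTheory.QuadraticFields.RedeiReichardt.redeiReichardt_fourTwoCard_classGroup ∧ Literature.NumberTheory.EllipticCurves.LiLiuTian2024.thm12_bsd_congruentNumberCurve ∧ Literature.NumberTheory.EllipticCurves.Monsky1990.cor515_rank_eq_one_and_card_selmerGroup_two ∧ Literature.NumberTheory.EllipticCurves.HeathBrown1994.monsky_card_selmerGroup_two_even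 ∧ Literature.NumberTheory.EllipticCurves.Tian2014.tian2014_system_sMinus_genus)) :
    RamifiedOffTYZOfFacts ↔ WAllCornerFTwoRamified :=
  ⟨fun h W _ _ hcm hr hram => ramifiedTwoRankOne_of_bundle_of_offTYZProved h hB W hcm hr hram,
    fun h _ => wAllCornerFTwoRamifiedOffTYZProved_of_wAllCornerFTwoRamified h⟩

/-- **Granted 𝔅_ram, crux 20509 ⟹ C⁺ (item 23431).**  On a jump-one `E_n` (square-free `n ≡ 5,6,7 (8)`, `ord_{s=1} L(E_n,s) = 1`,
`#Sel₂ = 2⁵`, `#Sel₄ = 2⁶`) the ramified slice gives `BSD(E_n, 2)` (`E_n` has CM by `ℤ[i]`, `2 ∣ d_K = −4`), and the level-two door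
`P2.bsdp_two_congruentNumberCurve_iff_two_dvd_not_four_dvd` (EXACT on that class, granted GZK = conjunct 1) turns it into `2 ∥ 𝓛(n)`.
[cite: TianYuanZhang2017, §1 (1.1)] [cite: Miller2011LMS, Def. 1.1] [cite: TopYui2008Congruent, Remark 3.4 (2)] -/
theorem levelTwo_of_ramifiedOffTYZ (hB : (Literature.NumberTheory.EllipticCurves.rank_eq_analyticRank_of_analyticRank_le_one ∧ WeierstrassCurve.hasEntireLFunction_rat ∧ WeierstrassCurve.bsdRHS_eq_of_isIsogenous ∧ Literature.NumberTheory.EllipticCurves.bsdTriple_of_hasCM_of_L_one_ne_zero ∧ Literature.NumberTheory.EllipticCurves.TianYuanZhang2017.thm12_parity_of_scriptL' ∧ Literature.NumberTheory.EllipticCurves.Tian2014.thm13_rank_one_and_sha_odd ∧ Literature.NumberTheory.QuadraticFields.RedeiReichardt.redeiReichardt_fourTwoCard_classGroup ∧ Literature.NumberTheory.EllipticCurves.LiLiuTian2024.thm12_bsd_congruentNumberCurve ∧ Literature.NumberTheory.EllipticCurves.Monsky1990.cor515_rank_eq_one_and_card_selmerGroup_two ∧ Literature.NumberTheory.EllipticCurves.HeathBrown1994.monsky_card_selmerGroup_two_even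 ∧ Literature.NumberTheory.EllipticCurves.Tian2014.tian2014_system_sMinus_genus))
    (h : RamifiedOffTYZOfFacts) : RamifiedJumpOneLevelTwoOfFacts := by
  intro n _ _ hsq _h8 hr hSel2 hSel4 L hL
  have hbsd : BSDp (congruentNumberCurve n) 2 :=
    ramifiedTwoRankOne_of_bundle_of_offTYZProved h hB (congruentNumberCurve n)
      (Literature.NumberTheory.EllipticCurves.LiLiuTian2024.hasCM_congruentNumberCurve n) hr
      (Literature.NumberTheory.EllipticCurves.LiLiuTian2024.cmRamified_two_congruentNumberCurve n)
  exact (Rank1Residual.P2.bsdp_two_congruentNumberCurve_iff_two_dvd_not_four_dvd hB.1 hsq hr hL hSel2 hSel4).1 hbsd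

/-- **Crux 20509 ⟹ the residual item 23432 `RamifiedOffJumpOneOfFacts`** (granted its own antecedent 𝔅_ram, every CM rank-one curve with
`2` ramified satisfies `BSD(E,2)` by `ramifiedOffTYZ_iff_wAllCornerFTwoRamified`; the residual's seven exclusions are idle). [folklore] -/
theorem offJumpOne_of_ramifiedOffTYZ (h : RamifiedOffTYZOfFacts) : RamifiedOffJumpOneOfFacts := by
  intro hB W _ _ hcm hr hram _ _ _ _ _ _
  exact ramifiedTwoRankOne_of_bundle_of_offTYZProved h hB W hcm hr hram

/-- **Crux 20509 from item 23431, item 23432 and the EIGHT named prints that open the six in-bundle doors** — the by-name bridge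
`RamifiedOffTYZOfFactsOfLevelTwo` (item 23433, p650357's `ramifiedOffTYZOfFacts_of_leaves_of_levelTwo_of_offJumpOneIsogeny`) with each door
stub `𝔅_ram → leaf` discharged by its printed closer: U⁺ (`tyz_genusPointData`, GZK, Tian 2014 Thm 1.3), Θ / Θ₄ / Θ-criterion
(`tyz_cmPointGaloisData`, TYZ Thm 1.1, GZK, Cassels, modularity), Shu–Zhai `256c1` (Cassels, SZ Thm 1.2/1.4, Rubin CM, modularity, ARS, base entry),
conductor `< 5000` (Creutz–Miller / Miller–Stoll).
[cite: TianYuanZhang2017, Thm. 1.1, Prop. 3.4, Thm. 3.5] [cite: Tian2014, Thm. 1.3] [cite: ShuZhai2021, Thm. 1.2, Thm. 1.4] [cite: AgasheRibetStein2006, Thm. 2.6]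
[cite: CreutzMiller2012, Thm. 1.1] [cite: MillerStoll2012, Thm. 9.1] [cite: Miller2011LMS, Def. 1.1] -/
theorem ramifiedOffTYZ_of_namedFacts_of_levelTwo_of_offJumpOne
    (hGP : Literature.NumberTheory.EllipticCurves.TianYuanZhang2017.tyz_genusPointData)
    (hCMG : Literature.NumberTheory.EllipticCurves.TianYuanZhang2017.tyz_cmPointGaloisData)
    (h11 : Literature.NumberTheory.EllipticCurves.TianYuanZhang2017.thm11_parity_of_scriptL)
    (hSZ12 : Literature.NumberTheory.EllipticCurves.ShuZhai2021.thm12_ranks_of_twists)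
    (hSZ14 : Literature.NumberTheory.EllipticCurves.ShuZhai2021.thm14_twoPartBSD_of_twists)
    (hARS : Literature.NumberTheory.EllipticCurves.AgasheRibetStein2006.cremona_abs_maninConstant_eq_one_of_level_le)
    (hbase : Literature.NumberTheory.EllipticCurves.ShuZhai2021.base256c1_optimal_cuspZero)
    (hS31 : Literature.NumberTheory.EllipticCurves.bsdTriple_of_analyticRank_le_one_of_conductor_lt)
    (hC : RamifiedJumpOneLevelTwoOfFacts) (hR : RamifiedOffJumpOneOfFacts) : RamifiedOffTYZOfFacts :=
  ramifiedOffTYZOfFacts_of_leaves_of_levelTwo_of_offJumpOneIsogeny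
    (fun hB => Rank1Residual.WAll.PrintCf2.wAllCornerFTwoRamifiedTYZUPlus_of_facts hGP hB.1 hB.2.2.2.2.2.1)
    (fun hB => wAllCornerFTwoRamifiedTheta_of_facts hCMG h11 hB.1)
    (fun hB => Summit.BirchSwinnertonDyer.wAllCornerFTwoRamifiedShuZhaiTwoFiftySix_of_facts hB.2.2.1 hSZ12 hSZ14 hB.2.2.2.1
      hB.2.1 hARS hbase)
    (fun hB => wAllCornerFTwoRamifiedThetaFour_of_facts hCMG h11 hB.1 hB.2.2.1 hB.2.1)
    (fun hB => wAllCornerFTwoRamifiedThetaCriterion_of_facts hCMG h11 hB.1 hB.2.2.1 hB.2.1)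
    (fun _ => ramifiedSmallConductor_of_S31 hS31) hC hR

/-- ★★ **Granted 𝔅_ram and the eight door prints, crux 20509 ⟺ item 23431 ∧ item 23432.**  (⟸ is unconditional in 𝔅_ram.)
[cite: TianYuanZhang2017, Thm. 1.1, Thm. 1.2, Thm. 3.5] [cite: Tian2014, Thm. 1.3] [cite: ShuZhai2021, Thm. 1.2, Thm. 1.4] [cite: CreutzMiller2012, Thm. 1.1] -/
theorem ramifiedOffTYZ_iff_levelTwo_and_offJumpOne_of_namedFacts
    (hGP : Literature.NumberTheory.EllipticCurves.TianYuanZhang2017.tyz_genusPointData)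
    (hCMG : Literature.NumberTheory.EllipticCurves.TianYuanZhang2017.tyz_cmPointGaloisData)
    (h11 : Literature.NumberTheory.EllipticCurves.TianYuanZhang2017.thm11_parity_of_scriptL)
    (hSZ12 : Literature.NumberTheory.EllipticCurves.ShuZhai2021.thm12_ranks_of_twists)
    (hSZ14 : Literature.NumberTheory.EllipticCurves.ShuZhai2021.thm14_twoPartBSD_of_twists)
    (hARS : Literature.NumberTheory.EllipticCurves.AgasheRibetStein2006.cremona_abs_maninConstant_eq_one_of_level_le)
    (hbase : Literature.NumberTheory.EllipticCurves.ShuZhai2021.base256c1_optimal_cuspZero)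
    (hS31 : Literature.NumberTheory.EllipticCurves.bsdTriple_of_analyticRank_le_one_of_conductor_lt)
    (hB : (Literature.NumberTheory.EllipticCurves.rank_eq_analyticRank_of_analyticRank_le_one ∧ WeierstrassCurve.hasEntireLFunction_rat ∧ WeierstrassCurve.bsdRHS_eq_of_isIsogenous ∧ Literature.NumberTheory.EllipticCurves.bsdTriple_of_hasCM_of_L_one_ne_zero ∧ Literature.NumberTheory.EllipticCurves.TianYuanZhang2017.thm12_parity_of_scriptL' ∧ Literature.NumberTheory.EllipticCurves.Tian2014.thm13_rank_one_and_sha_odd ∧ Literature.NumberTheory.QuadraticFields.RedeiReichardt.redeiReichardt_fourTwoCard_classGroup ∧ Literature.NumberTheory.EllipticCurves.LiLiuTian2024.thm12_bsd_congruentNumberCurve ∧ Literature.NumberTheory.EllipticCurves.Monsky1990.cor515_rank_eq_one_and_card_selmerGroup_two ∧ Literature.NumberTheory.EllipticCurves.HeathBrown1994.monsky_card_selmerGroup_two_even ∧ Literature.NumberTheory.EllipticCurves.Tian2014.tian2014_system_sMinus_genus)) :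
    RamifiedOffTYZOfFacts ↔ RamifiedJumpOneLevelTwoOfFacts ∧ RamifiedOffJumpOneOfFacts :=
  ⟨fun h => ⟨levelTwo_of_ramifiedOffTYZ hB h, offJumpOne_of_ramifiedOffTYZ h⟩,
    fun h => ramifiedOffTYZ_of_namedFacts_of_levelTwo_of_offJumpOne hGP hCMG h11 hSZ12 hSZ14 hARS hbase hS31 h.1 h.2⟩

/-- **Crux 20509 from the three named laws, item 23432 and the TEN named prints** (eight door prints + the TYZ value door + THEOREM A's
prints) — skeleton v15's second composition `RamifiedOffTYZOfFacts_of_recut` with every `sorry` replaced by a named hypothesis.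
[cite: TianYuanZhang2017, §3.1–3.2, Thm. 1.1, Thm. 1.2, Thm. 3.5] [cite: Yang2006DefiningEquations, §4.1] [cite: Cox2013, Thm. 15.16, Thm. 15.17] -/
theorem ramifiedOffTYZ_of_namedFacts_of_laws_of_offJumpOne
    (hGP : Literature.NumberTheory.EllipticCurves.TianYuanZhang2017.tyz_genusPointData)
    (hCMG : Literature.NumberTheory.EllipticCurves.TianYuanZhang2017.tyz_cmPointGaloisData)
    (h11 : Literature.NumberTheory.EllipticCurves.TianYuanZhang2017.thm11_parity_of_scriptL)
    (hSZ12 : Literature.NumberTheory.EllipticCurves.ShuZhai2021.thm12_ranks_of_twists)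
    (hSZ14 : Literature.NumberTheory.EllipticCurves.ShuZhai2021.thm14_twoPartBSD_of_twists)
    (hARS : Literature.NumberTheory.EllipticCurves.AgasheRibetStein2006.cremona_abs_maninConstant_eq_one_of_level_le)
    (hbase : Literature.NumberTheory.EllipticCurves.ShuZhai2021.base256c1_optimal_cuspZero)
    (hS31 : Literature.NumberTheory.EllipticCurves.bsdTriple_of_analyticRank_le_one_of_conductor_lt)
    (hT : Literature.NumberTheory.EllipticCurves.TianYuanZhang2017.tyz_sevenBlockCMValueData)
    (hP : (Literature.NumberTheory.EllipticCurves.ModularForms.x032_φ_eq_etaQuotient ∧ Literature.NumberTheory.EllipticCurves.ModularForms.x032_φ_injective ∧ Literature.NumberTheory.ComplexMultiplication.Cox2013.cox2013_shimuraReciprocity_rayClassField))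
    (hZ : LawZPlusSecondNormVisibleR2) (hI : LawLevelTwoInvisibleR2) (hO : LawLevelTwoOffR2)
    (hR : RamifiedOffJumpOneOfFacts) : RamifiedOffTYZOfFacts :=
  fun hB => ramifiedOffTYZ_of_namedFacts_of_levelTwo_of_offJumpOne hGP hCMG h11 hSZ12 hSZ14 hARS hbase hS31 (levelTwo_of_laws hB hT hP hZ hI hO) hR hB

/-- ★★ **Granted 𝔅_ram and the ten named prints, crux 20509 ⟺ (LawZ⁺ ∧ LawInvisR2 ∧ LawOffR2) ∧ item 23432** — the exact dependency
statement of record for the wall label «20509 = IDEA-BOUND (conditional on LAW Z⁺ + 2 named laws; rung 0 = THEOREM A proved)»: modulo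
the prints, the crux is neither more nor less than its three named open conjectures plus its named residual.
[cite: TianYuanZhang2017, §3.1–3.2, Thm. 1.1, Thm. 1.2, Thm. 3.5] [cite: Yang2006DefiningEquations, §4.1] [cite: Cox2013, Thm. 15.16, Thm. 15.17]
[cite: ShuZhai2021, Thm. 1.2, Thm. 1.4] [cite: CreutzMiller2012, Thm. 1.1] -/
theorem ramifiedOffTYZ_iff_laws_and_offJumpOne_of_namedFacts
    (hGP : Literature.NumberTheory.EllipticCurves.TianYuanZhang2017.tyz_genusPointData)
    (hCMG : Literature.NumberTheory.EllipticCurves.TianYuanZhang2017.tyz_cmPointGaloisData)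
    (h11 : Literature.NumberTheory.EllipticCurves.TianYuanZhang2017.thm11_parity_of_scriptL)
    (hSZ12 : Literature.NumberTheory.EllipticCurves.ShuZhai2021.thm12_ranks_of_twists)
    (hSZ14 : Literature.NumberTheory.EllipticCurves.ShuZhai2021.thm14_twoPartBSD_of_twists)
    (hARS : Literature.NumberTheory.EllipticCurves.AgasheRibetStein2006.cremona_abs_maninConstant_eq_one_of_level_le)
    (hbase : Literature.NumberTheory.EllipticCurves.ShuZhai2021.base256c1_optimal_cuspZero)
    (hS31 : Literature.NumberTheory.EllipticCurves.bsdTriple_of_analyticRank_le_one_of_conductor_lt)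
    (hT : Literature.NumberTheory.EllipticCurves.TianYuanZhang2017.tyz_sevenBlockCMValueData)
    (hP : (Literature.NumberTheory.EllipticCurves.ModularForms.x032_φ_eq_etaQuotient ∧ Literature.NumberTheory.EllipticCurves.ModularForms.x032_φ_injective ∧ Literature.NumberTheory.ComplexMultiplication.Cox2013.cox2013_shimuraReciprocity_rayClassField))
    (hB : (Literature.NumberTheory.EllipticCurves.rank_eq_analyticRank_of_analyticRank_le_one ∧ WeierstrassCurve.hasEntireLFunction_rat ∧ WeierstrassCurve.bsdRHS_eq_of_isIsogenous ∧ Literature.NumberTheory.EllipticCurves.bsdTriple_of_hasCM_of_L_one_ne_zero ∧ Literature.NumberTheory.EllipticCurves.TianYuanZhang2017.thm12_parity_of_scriptL' ∧ Literature.NumberTheory.EllipticCurves.Tian2014.thm13_rank_one_and_sha_odd ∧ Literature.NumberTheory.QuadraticFields.RedeiReichardt.redeiReichardt_fourTwoCard_classGroup ∧ Literature.NumberTheory.EllipticCurves.LiLiuTian2024.thm12_bsd_congruentNumberCurve ∧ Literature.NumberTheory.EllipticCurves.Monsky1990.cor515_rank_eq_one_and_card_selmerGroup_two ∧ Literature.NumberTheory.EllipticCurves.HeathBrown1994.monsky_card_selmerGroup_two_even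 ∧ Literature.NumberTheory.EllipticCurves.Tian2014.tian2014_system_sMinus_genus)) :
    RamifiedOffTYZOfFacts ↔
      (LawZPlusSecondNormVisibleR2 ∧ LawLevelTwoInvisibleR2 ∧ LawLevelTwoOffR2) ∧ RamifiedOffJumpOneOfFacts :=
  ⟨fun h => ⟨laws_of_levelTwo (levelTwo_of_ramifiedOffTYZ hB h), offJumpOne_of_ramifiedOffTYZ h⟩,
    fun h => ramifiedOffTYZ_of_namedFacts_of_laws_of_offJumpOne hGP hCMG h11 hSZ12 hSZ14 hARS hbase hS31 hT hP h.1.1 h.1.2.1 h.1.2.2 h.2⟩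

end Summit.BirchSwinnertonDyer.PrintCf2.NamedLawsClosure

end
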